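import Literature.NumberTheory.EllipticCurves.KrizLi2019.TwoPartBSDTwists
import Literature.NumberTheory.EllipticCurves.Zhai2021.TwoAdicLowerBoundTwists
import HarnessLib

/-!
# Kriz–Li 2019 (FMS 7, e15), §6 Table 1 («Assumption (★) for rank one curves») — the row `92b1` AS PRINTED: for the optimal curve
# `E = 92b1` and `K = ℚ(√−7)`, Assumption (★) holds (statement-only named fact; the per-curve input of Thm 5.1 (2) = `thm112_bsdTwo_twist` at
# the only RANK-ONE row of the table that is ADDITIVE at `2` with `c₂` odd and `49·N < 5000`)

HONEST FRAMING (cell `bsd-2adic`, seat `bsd-2adic-k4-w2` GEN 7, K4 crux `AdditiveRankZeroAtTwo` 19098, children C3″ 22617 / C1″ 22615;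
2026-08-29): a PUBLISHED per-curve computational assertion (a check-mark in a table of a refereed paper) vendored as a named `Prop` —
nothing asserted, nothing discharged (D-0014) — with a locator into the held source; companion of `KrizLi2019.table1_row243a1` (cell
`bsd-print-cf2`, the CM row) and of `KrizLi2019.table2_row44a1/_row92a1` (`Table2RankZeroRows.lean`, this seat), same shape as the latter
(the OPTIMAL parametrisation datum is transcribed because `92b1` is additive at `2`, where Thm 5.1 (2) wants the Manin constant odd — the
consumer derives it from optimality by Agashe–Ribet–Stein Thm. 2.6). For the RANK-ONE base `92b1` the Kriz–Li family `{92b1^{(d)}}`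
consists of rank-one curves and the companions `{92b1^{(−7d)}}` are RANK-ZERO, `E[2]`-irreducible, additive potentially good at `2` — the
members the K4 crux C3″ quantifies over. Everything else about the row is decided IN THE KERNEL by the consumer
(`Summits/BirchSwinnertonDyer/BirchSwinnertonDyer/Theorems/ByReductionTypeAtTwoAdditivePotGoodPrintKrizLi92b1*.lean`: `E(ℚ)[2] = 0`, a point of
infinite order, the Heegner hypothesis for `(92, −7)`, `c₂ = 3` odd and `N = 92` by a Tate certificate, `N(92b1^{(−7)}) = 4508`) or taken BY
NAME from print (Creutz–Miller for `BSD(92b1, 2)`, `BSD(92b1^{(−7)}, 2)`; Gross–Zagier–Kolyvagin). Nothing is booked here; BSD is not proved by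
any of this.

Source. D. Kriz, C. Li, *Goldfeld's conjecture and congruences between Heegner points*, Forum Math. Sigma **7** (2019), e15,
doi:10.1017/fms.2019.9 [KrizLi2019] = arXiv:1606.03172 (§§1–6). Texts read: the held chunk texts `paper:doi-10-1017-fms-2019-9` (p0017
L21: Example 6.2) and `paper:arxiv-1606.03172` (p0019 L41), which DROP the table body; the table itself was read in the arXiv v3 source
`Congruence.tex` (copy at `run/shared/lean/pub/bsd-print-cf2/lit/krizli2019/arXiv-1606.03172v3-Congruence.tex`), ll. 964–1017
(`\label{tab:1}`, Example 6.2), row at line 976.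

## The printed statement (verbatim)

* Example 6.2 (tex l. 965): "We search for rank one optimal elliptic curves with `E(ℚ)[2] = 0` satisfying these two necessary conditions.
  There are 38 such curves of conductor `≤ 300`. For each curve, we choose `K` with smallest `|d_K|` satisfying the Heegner hypothesis for
  `N` and such that `2` is split in `K`. Then 31 out of 38 curves satisfy (★). See Table 1. The first three columns list `E`, `d_K` and the
  local Tamagawa number `c₂(E)` at `2` respectively. A check-mark in the last column means that (★) holds … If `c₂(E)` is further odd (true
  for 23 out of 31), then the application to BSD(2) (Theorem 5.1) also applies."
* Table 1, caption "Assumption (★) for rank one curves", header `E | d_K | c₂(E) | ★`, rows (tex ll. 971–977): "`37a1 & -7 & 1 & ✓`",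
  "`43a1 & -7 & 1 & ✓`", "`88a1 & -7 & 4 & ✓`", "`91a1 & -55 & 1 & ✓`", "`91b1 & -55 & 1 & ✓`", "**`92b1 & -7 & 3 & ✓`**", "`101a1 & -23 & 1 & ✓`", ….

## Transcription (tree dictionary of `KrizLi2019/TwoPartBSDTwists.lean`)

`E = 92b1` = Cremona's globally minimal model `[0, 0, 0, −1, 1]` (`y² = x³ − x + 1`; `Δ = −368 = −2⁴·23`, `c₄ = 48`, conductor `92`,
Kodaira `IV, I₁`, `c_p = (3, 1)`, `E(ℚ) ≅ ℤ` generated by `(1, 1)`, `r = 1`; Cremona 1992 Table 1 p. 134 «92 B1(C)»). "`K = ℚ(√−7)`" = any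
`K` with `IsImaginaryQuadratic K` and `NumberField.discr K = −7`. "Optimal curve with its parametrisation" = a datum
`Dt : ModularParametrizationData E N` at the conductor level (`NeZero` witness packed) with `Zhai2021.IsOptimalDatum E Dt`; "(★) holds" =
a Heegner datum `H`, an embedding `ι`, a point `P ∈ E(K)` mapping to `heegnerPointComplex Dt H`, and `j : K →ₐ[ℚ] ℚ₂` with
`AssumptionStar E Dt K P j` — the binders of `thm112_bsdTwo_twist` / `thm33_rank_twist`. Global minimality of the printed model is a binder
`[IsGloballyMinimal]`. "Rank one", "`E(ℚ)[2] = 0`", "`c₂(E) = 3`" are NOT transcribed (kernel-side in the consumer). Nothing weaker or stronger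
is transcribed; no `_holds` is expected. Status: PUB (refereed); per-curve computational TABLE entry, flag word for the referee: TABLE.

## References
* [KrizLi2019] §6 Example 6.2 and Table 1 (row 92b1) (FMS chunk p0017 L21; arXiv:1606.03172v3 `Congruence.tex` ll. 965, 976); Assumption (★)
  (arXiv p0003 L45–L48); Thm 5.1 (2) = arXiv Thm 1.12.
* [CremonaAlgorithms1997] Table 1 (curve 92B1 = `[0,0,0,−1,1]`, held scan p. 134).
* [Zhai2021BSDExactFormulaTwists] §1 (the optimality predicate `IsOptimalDatum`).
-/

noncomputable section

open scoped Classical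

open NumberField WeierstrassCurve Literature.NumberTheory.EllipticCurves
  Literature.NumberTheory.EllipticCurves.ModularForms

namespace Literature.NumberTheory.EllipticCurves.KrizLi2019

/-- **Kriz–Li 2019, §6 Table 1, row `92b1`** (verbatim in the module docstring: `92b1 | d_K = −7 | c₂(E) = 3 | ★ ✓`; Example 6.2 "rank
one optimal curves … `K` with smallest `|d_K|`"): for every imaginary quadratic field `K` of discriminant `−7`, the optimal curve `92b1` on
its (globally minimal) model `[0,0,0,−1,1]` admits an OPTIMAL modular parametrisation datum `Dt` at level `N(E)`, a Heegner datum `H` of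
discriminant `d_K` and level `N(E)`, an embedding `ι : K → ℂ`, a point `P ∈ E(K)` mapping to `heegnerPointComplex Dt H`, and `j : K → ℚ₂`
with Assumption (★) `AssumptionStar E Dt K P j`. Statement only; TABLE entry in a refereed paper; no `_holds` expected.
[cite: KrizLi2019, §6 Table 1 (row 92b1) and Example 6.2 (FMS 7 (2019) e15, chunk p0017 L21; arXiv:1606.03172v3 Congruence.tex ll. 965, 976)] -/
def table1_row92b1 : Prop :=
  ∀ [(⟨0, 0, 0, -1, 1⟩ : WeierstrassCurve ℚ).IsGloballyMinimal]
    (K : Type) [Field K] [NumberField K], IsImaginaryQuadratic K → NumberField.discr K = -7 →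
    ∃ (_ : NeZero ((⟨0, 0, 0, -1, 1⟩ : WeierstrassCurve ℚ).conductorNorm ℤ))
      (Dt : ModularParametrizationData (⟨0, 0, 0, -1, 1⟩ : WeierstrassCurve ℚ)
        ((⟨0, 0, 0, -1, 1⟩ : WeierstrassCurve ℚ).conductorNorm ℤ))
      (H : HeegnerDatum ((⟨0, 0, 0, -1, 1⟩ : WeierstrassCurve ℚ).conductorNorm ℤ) (NumberField.discr K))
      (ι : K →+* ℂ) (P : ((⟨0, 0, 0, -1, 1⟩ : WeierstrassCurve ℚ).baseChange K).toAffine.Point)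
      (j : K →ₐ[ℚ] ℚ_[2]),
      Zhai2021.IsOptimalDatum (⟨0, 0, 0, -1, 1⟩ : WeierstrassCurve ℚ) Dt ∧
        WeierstrassCurve.Affine.Point.map ι.toRatAlgHom P = heegnerPointComplex Dt H ∧
          AssumptionStar (⟨0, 0, 0, -1, 1⟩ : WeierstrassCurve ℚ) Dt K P j

end Literature.NumberTheory.EllipticCurves.KrizLi2019

end
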